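import Literature.Geometry.Riemannian.TransverseJacobiDerivative
import Literature.Geometry.Riemannian.NormalExponentialMap
import Literature.Geometry.Riemannian.JacobiVariation
import Literature.Geometry.Riemannian.VolumeSphereTheoremJacobiFrameProofs
import Literature.Geometry.Lorentzian.GaussEquationFrame
import Literature.Geometry.Lorentzian.HypersurfaceRestriction
import HarnessLib

/-!
# Jacobi fields of the normal exponential map of a field along a map

Layer L4 (null focusing / existence of focal points; O'Neill 1983, Ch. 10, Props. 30, 43;
Hawking–Ellis 1973, §4.4, Prop. 4.4.6) of the proof programme of
`Literature.Geometry.Lorentzian.ChruscielEtAl2001_areaTheorem` (Chruściel–Delay–Galloway–Howard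
2001, Prop. 4.17) and of "half 2" of the Penrose singularity theorem
(`PenroseSingularityTheoremProofs.lean`). For a map `ι : N → M`, a field `ν` along `ι`
(`ν z ∈ T_{ι z}M`) with `z ↦ (ι z, ν z) ∈ TM` of class `C^∞`, and a curve `c` in `N`, the
**variation through the normal geodesics** `x(t, s) = exp_{ι(c s)}(t ν(c s)) = E(c s, t)`,
`E(z, t) = exp_{ι z}(t ν z)` the normal exponential map of `NormalExponentialMap.lean`, is `C^∞`
near every `(t₀, s₀)` with `t₀ ∈ dom γ_{(ι(c s₀), ν(c s₀))}` (no completeness is assumed: the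
domain of `E` is open, Lee 2018, Prop. 5.19), its `t`-curves are geodesics, and hence its variation
field `J = ∂_s x(·, s₀)` is a Jacobi field along the normal geodesic (O'Neill 1983, Ch. 8, Lemma 3;
Ch. 10, Cor. 40: for `P` a submanifold and `ν` normal these are exactly the `P`-Jacobi fields).

* `contMDiffAt_lift_velocity_uncurry_left_of_eventually` (and `_right_`): local form of the
  smoothness of the lift `(t, s) ↦ (x, ∂_t x) ∈ TM` of a partial velocity;
* `jacobi_of_variation_through_geodesics`: **variations through geodesics give Jacobi fields**,
  LOCAL form (smoothness and the geodesic equation only near `(t₀, s₀)`; locality of `D/dt`,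
  `covariantDerivAlong_congr_of_eventuallyEq`);
* `eventually_contMDiffAt_uncurry_normalExpVariation`, `eventually_geodesic_normalExpVariation`,
  `normalExpVariation_jacobi`: the normal exponential variation is `C^∞` near `(t₀, s₀)`, its
  `t`-curves are geodesics, `J` satisfies the Jacobi equation, `D_t J = D_s ∂_t x`, and the lifts of
  `J`, `D_t J` are differentiable;
* `velocity_normalExpVariation_zero`, `covariantDerivAlong_normalExpVariation_zero`: initial data
  `J(0) = (ι ∘ c)'(s₀)`, `D_s ∂_t x(0, s₀) = D_s(ν ∘ c)(s₀)` (for the chart-straight curve through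
  `z` with velocity `w`: `J(0) = dι_z w`, `D_t J(0) = D_w ν`, the `P`-Jacobi condition);
* `velocity_normalExpVariation_eq_mfderiv`, `mfderiv_normalExp_apply`: `J(t) = d(E(·, t))(c'(s₀))`
  and `dE_{(z,t)}(w, a) = d(E(·, t))_z w + a γ̇(t)` — so zeros of `J + a γ̇` are singular points of
  `E` (O'Neill 1983, Ch. 10, Prop. 30 (3), focal points);
* `hasDerivAt_wronskian_of_isJacobiFieldAlongOn`: the Wronskian `g(D_t J₁, J₂) - g(J₁, D_t J₂)` of
  two Jacobi fields has zero derivative (O'Neill 1983, Ch. 8, Lemma 7);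
* `exists_strip_subset_normalExpDomain`, `val_jacobi_velocity_eq_zero_of_normal`,
  `val_covariantDerivAlong_jacobi_velocity_eq_zero_of_normal`: for `g(ν, ν)` constant along `c`
  and `ν(c 0) ⊥ dι(c'(0))` (null or unit normal data), `J ⊥ γ̇` and `D_t J ⊥ γ̇` along the whole
  normal geodesic (Gauss lemma for submanifolds, Lee 2018, Thm. 6.38, on a strip given by the tube
  lemma).

Stated for a general `C^∞`/`C¹` connection `cov` on a Hausdorff manifold without boundary
(`T2Space`, `BoundarylessManifold`), resp. for the Levi-Civita connection of a `C^n`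
pseudo-Riemannian metric (`n ≥ 1`, resp. `n ≥ 2` for curvature symmetries); no signature
assumption. No definitions, no named facts (D-0026).

## References

* B. O'Neill, *Semi-Riemannian geometry with applications to relativity* (1983), Ch. 4, p. 122;
  Ch. 8, Lemmas 3 and 7; Ch. 10, Def. 29, Prop. 30, Cor. 40, p. 289.
* J. M. Lee, *Introduction to Riemannian Manifolds*, 2nd ed. (2018), Prop. 5.19, Thm. 5.25,
  Thm. 6.38, Thm. 10.1, Problem 10-14.
* I. Chavel, *Riemannian geometry: a modern introduction*, 2nd ed. (2006), Thm. III.4.3.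
* S. W. Hawking, G. F. R. Ellis, *The large scale structure of space-time* (1973), §4.2, §4.4.
-/

noncomputable section

open Bundle Set Filter Function
open scoped Manifold ContDiff Topology

namespace Literature.Geometry.Lorentzian

open Literature.Geometry.Riemannian

variable {E : Type*} [NormedAddCommGroup E] [NormedSpace ℝ E] {H : Type*} [TopologicalSpace H]
  {I : ModelWithCorners ℝ E H} {M : Type*} [TopologicalSpace M] [ChartedSpace H M]
  [IsManifold I ∞ M]

/-! ### Local form of the smoothness of the lift of a partial velocity -/

/-- **The partial velocity `x_t` of a two-parameter map which is `C^∞` near `(t₀, s₀)` has a lift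
`(t, s) ↦ (x(t, s), x_t(t, s)) ∈ TM` which is `C^∞` at `(t₀, s₀)`** — the local form of
`contMDiff_lift_velocity_uncurry_left` (`ExpMapJacobiField.lean`): in the trivialisation at
`x(t₀, s₀)` the fibre coordinate is, near `(t₀, s₀)`, the `t`-derivative of the `C^∞` chart
expression. O'Neill 1983, Ch. 4, p. 122. [cite: ONeillSemiRiemannian1983, Ch. 4, p. 122] -/
theorem contMDiffAt_lift_velocity_uncurry_left_of_eventually {x : ℝ → ℝ → M} {t₀ s₀ : ℝ}
    (hx : ∀ᶠ q in 𝓝 (t₀, s₀), ContMDiffAt (𝓘(ℝ, ℝ).prod 𝓘(ℝ, ℝ)) I ∞ (uncurry x) q) :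
    ContMDiffAt (𝓘(ℝ, ℝ).prod 𝓘(ℝ, ℝ)) I.tangent ∞
      (fun q : ℝ × ℝ ↦ (TotalSpace.mk' E (x q.1 q.2) (velocity I (fun t ↦ x t q.2) q.1) :
        TangentBundle I M)) (t₀, s₀) := by
  have hx0 : ContMDiffAt (𝓘(ℝ, ℝ).prod 𝓘(ℝ, ℝ)) I ∞ (uncurry x) (t₀, s₀) := hx.self_of_nhds
  set e := trivializationAt E (TangentSpace I : M → Type _) (x t₀ s₀) with he_def
  have hcont : ContinuousAt (fun q : ℝ × ℝ ↦ x q.1 q.2) (t₀, s₀) := hx0.continuousAt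
  have hsrc : ∀ᶠ q : ℝ × ℝ in 𝓝 (t₀, s₀), x q.1 q.2 ∈ (chartAt H (x t₀ s₀)).source :=
    hcont.preimage_mem_nhds
      ((chartAt H (x t₀ s₀)).open_source.mem_nhds (mem_chart_source H (x t₀ s₀)))
  have hmem : (TotalSpace.mk' E (x t₀ s₀) (velocity I (fun t ↦ x t s₀) t₀) : TangentBundle I M) ∈
      e.source :=
    e.mem_source.2 (FiberBundle.mem_baseSet_trivializationAt' (x t₀ s₀))
  rw [e.contMDiffAt_iff
    (f := fun q : ℝ × ℝ ↦ (TotalSpace.mk' E (x q.1 q.2) (velocity I (fun t ↦ x t q.2) q.1) :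
      TangentBundle I M)) hmem]
  refine ⟨hx0, ?_⟩
  have hX : ContDiffAt ℝ ∞ (fun q : ℝ × ℝ ↦ extChartAt I (x t₀ s₀) (x q.1 q.2)) (t₀, s₀) :=
    contDiffAt_extChartAt_uncurry hx0
  have hF : ContDiffAt ℝ ∞ (uncurry fun (q : ℝ × ℝ) (t' : ℝ) ↦ extChartAt I (x t₀ s₀) (x t' q.2))
      ((t₀, s₀), t₀) := by
    have hlin : ContDiff ℝ ∞ (fun z : (ℝ × ℝ) × ℝ ↦ ((z.2, z.1.2) : ℝ × ℝ)) :=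
      (contDiff_snd.prodMk (contDiff_snd.comp contDiff_fst))
    have h := hX.comp ((t₀, s₀), t₀) hlin.contDiffAt
    exact h
  have hD : ContDiffAt ℝ ∞
      (fun q : ℝ × ℝ ↦ fderiv ℝ (fun t' ↦ extChartAt I (x t₀ s₀) (x t' q.2)) q.1 (1 : ℝ)) (t₀, s₀) := by
    have h1 : ContDiffAt ℝ ∞
        (fun q : ℝ × ℝ ↦ fderiv ℝ (fun t' ↦ extChartAt I (x t₀ s₀) (x t' q.2)) q.1) (t₀, s₀) :=
      ContDiffAt.fderiv (f := fun (q : ℝ × ℝ) (t' : ℝ) ↦ extChartAt I (x t₀ s₀) (x t' q.2))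
        (g := fun q : ℝ × ℝ ↦ q.1) hF contDiffAt_fst (by simp)
    exact h1.clm_apply contDiffAt_const
  have heq : (fun q : ℝ × ℝ ↦ (e ⟨x q.1 q.2, velocity I (fun t ↦ x t q.2) q.1⟩).2) =ᶠ[𝓝 (t₀, s₀)]
      fun q : ℝ × ℝ ↦ fderiv ℝ (fun t' ↦ extChartAt I (x t₀ s₀) (x t' q.2)) q.1 (1 : ℝ) := by
    filter_upwards [hsrc, hx] with q hq hxq
    have hxq' : ContMDiffAt (𝓘(ℝ, ℝ).prod 𝓘(ℝ, ℝ)) I ∞ (uncurry x) (q.1, q.2) := hxq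
    rw [he_def, trivializationAt_velocity_curry_left
      (mdifferentiableAt_curry_left hxq' (by simp)) hq]
    rfl
  have hD' : ContMDiffAt (𝓘(ℝ, ℝ).prod 𝓘(ℝ, ℝ)) 𝓘(ℝ, E) ∞
      (fun q : ℝ × ℝ ↦ fderiv ℝ (fun t' ↦ extChartAt I (x t₀ s₀) (x t' q.2)) q.1 (1 : ℝ)) (t₀, s₀) := by
    have h := contMDiffAt_iff_contDiffAt.2 hD
    rw [modelWithCornersSelf_prod, ← chartedSpaceSelf_prod] at h
    exact h
  exact hD'.congr_of_eventuallyEq heq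

/-- Flipped form: the partial velocity `x_s` has a `C^∞` lift `(t, s) ↦ (x(t, s), x_s(t, s))` at
`(t₀, s₀)` when `x` is `C^∞` near `(t₀, s₀)`. [cite: ONeillSemiRiemannian1983, Ch. 4, p. 122] -/
theorem contMDiffAt_lift_velocity_uncurry_right_of_eventually {x : ℝ → ℝ → M} {t₀ s₀ : ℝ}
    (hx : ∀ᶠ q in 𝓝 (t₀, s₀), ContMDiffAt (𝓘(ℝ, ℝ).prod 𝓘(ℝ, ℝ)) I ∞ (uncurry x) q) :
    ContMDiffAt (𝓘(ℝ, ℝ).prod 𝓘(ℝ, ℝ)) I.tangent ∞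
      (fun q : ℝ × ℝ ↦ (TotalSpace.mk' E (x q.1 q.2) (velocity I (x q.1) q.2) :
        TangentBundle I M)) (t₀, s₀) := by
  -- apply the left version to the flipped map at `(s₀, t₀)` and flip back
  have hswap : ContMDiffAt (𝓘(ℝ, ℝ).prod 𝓘(ℝ, ℝ)) (𝓘(ℝ, ℝ).prod 𝓘(ℝ, ℝ)) ∞
      (fun q : ℝ × ℝ ↦ (q.2, q.1)) (t₀, s₀) := contMDiffAt_snd.prodMk contMDiffAt_fst
  have hcont : ContinuousAt (fun q : ℝ × ℝ ↦ ((q.2, q.1) : ℝ × ℝ)) (s₀, t₀) :=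
    (continuous_snd.prodMk continuous_fst).continuousAt
  have hx' : ∀ᶠ q in 𝓝 (s₀, t₀), ContMDiffAt (𝓘(ℝ, ℝ).prod 𝓘(ℝ, ℝ)) I ∞ (uncurry (flip x)) q := by
    have h := hcont.eventually hx
    filter_upwards [h] with q hq
    exact contMDiffAt_uncurry_flip hq
  have h := contMDiffAt_lift_velocity_uncurry_left_of_eventually (I := I) hx'
  exact h.comp (t₀, s₀) hswap

/-! ### Variations through geodesics give Jacobi fields (local form) -/

section Jacobi

variable [FiniteDimensional ℝ E] [CompleteSpace E]
  {cov : CovariantDerivative I E (TangentSpace I : M → Type _)}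

/-- **Variations through geodesics give Jacobi fields, local form** (O'Neill 1983, Ch. 8,
Lemma 3; Lee 2018, Thm. 10.1): if the two-parameter map `x` is `C^∞` near `(t₀, s₀)` and its
`t`-curves are geodesics of the torsion-free, locally `C¹` connection `cov` near `(t₀, s₀)` (the
geodesic equation `D_t ∂_t x = 0` holding at all `(t, s)` near `(t₀, s₀)`), then the variation
field `S = ∂_s x(·, s₀)` satisfies the Jacobi equation `D_t D_t S + R(S, ∂_t x) ∂_t x = 0` at `t₀`
along `x(·, s₀)`. Proof as in `jacobi_geodesicVariation` (`JacobiVariation.lean`), with the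
locality of `D/dt` (`covariantDerivAlong_congr_of_eventuallyEq`) replacing the global
hypotheses: `D_t D_t ∂_s x = D_t D_s ∂_t x` (symmetry lemma near `t₀`)
`= D_s D_t ∂_t x + R(∂_t x, ∂_s x) ∂_t x` (curvature identity) `= -R(∂_s x, ∂_t x) ∂_t x`.
[cite: ONeillSemiRiemannian1983, Ch. 8, Lemma 3] [cite: LeeRiemannianManifolds2018, Thm. 10.1] -/
theorem jacobi_of_variation_through_geodesics (hcov₁ : cov.IsLocallyContMDiff 1)
    (htors : cov.torsion = 0) {x : ℝ → ℝ → M} {t₀ s₀ : ℝ}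
    (hx : ∀ᶠ q in 𝓝 (t₀, s₀), ContMDiffAt (𝓘(ℝ, ℝ).prod 𝓘(ℝ, ℝ)) I ∞ (uncurry x) q)
    (hgeo : ∀ᶠ q : ℝ × ℝ in 𝓝 (t₀, s₀), covariantDerivAlong cov (fun t ↦ x t q.2)
      (fun t ↦ velocity I (fun t ↦ x t q.2) t) q.1 = 0) :
    covariantDerivAlong cov (fun t ↦ x t s₀)
        (fun t ↦ covariantDerivAlong cov (fun t ↦ x t s₀) (fun t ↦ velocity I (x t) s₀) t) t₀ +
      cov.curvature (x t₀ s₀) (velocity I (x t₀) s₀) (velocity I (fun t ↦ x t s₀) t₀)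
        (velocity I (fun t ↦ x t s₀) t₀) = 0 := by
  have h2 : (2 : ℕ∞ω) ≤ ∞ := WithTop.coe_le_coe.2 le_top
  have hX2 : ∀ᶠ q in 𝓝 (t₀, s₀), ContMDiffAt (𝓘(ℝ, ℝ).prod 𝓘(ℝ, ℝ)) I 2 (uncurry x) q :=
    hx.mono fun q hq ↦ hq.of_le h2
  have hX2₀ : ContMDiffAt (𝓘(ℝ, ℝ).prod 𝓘(ℝ, ℝ)) I 2 (uncurry x) (t₀, s₀) := hX2.self_of_nhds
  -- symmetry lemma near `t₀` along the line `s = s₀`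
  have hline : Tendsto (fun t : ℝ ↦ ((t, s₀) : ℝ × ℝ)) (𝓝 t₀) (𝓝 (t₀, s₀)) :=
    (continuous_id.prodMk continuous_const).continuousAt
  have hsymm : ∀ᶠ t in 𝓝 t₀, covariantDerivAlong cov (fun t' ↦ x t' s₀)
      (fun t' ↦ velocity I (x t') s₀) t =
      covariantDerivAlong cov (x t) (fun s ↦ velocity I (fun t' ↦ x t' s) t) s₀ := by
    filter_upwards [hline.eventually hX2] with t ht
    exact covariantDerivAlong_velocity_comm cov htors ht
  -- the lift of `∂_t x` is `C²` at `(t₀, s₀)`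
  have hT : ContMDiffAt (𝓘(ℝ, ℝ).prod 𝓘(ℝ, ℝ)) I.tangent 2
      (fun q : ℝ × ℝ ↦ (TotalSpace.mk' E (x q.1 q.2) (velocity I (fun t' ↦ x t' q.2) q.1) :
        TangentBundle I M)) (t₀, s₀) :=
    (contMDiffAt_lift_velocity_uncurry_left_of_eventually (I := I) hx).of_le h2
  -- curvature identity for `Z = ∂_t x` at `(t₀, s₀)`
  have hcurv := covariantDerivAlong_covariantDerivAlong_sub_eq_curvature (cov := cov) hcov₁
    (x := x) (Z := fun t s ↦ velocity I (fun t' ↦ x t' s) t) (t := t₀) (s := s₀) hX2₀ hT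
  beta_reduce at hcurv
  -- the term `D_s (D_t ∂_t x)(t₀, ·)` vanishes: the field is zero near `s₀`
  have hcol : Tendsto (fun s : ℝ ↦ ((t₀, s) : ℝ × ℝ)) (𝓝 s₀) (𝓝 (t₀, s₀)) :=
    (continuous_const.prodMk continuous_id).continuousAt
  have hzero : covariantDerivAlong cov (x t₀) (fun s ↦ covariantDerivAlong cov (fun t' ↦ x t' s)
      (fun t' ↦ velocity I (fun t' ↦ x t' s) t') t₀) s₀ = 0 := by
    have hev : (fun s ↦ (TotalSpace.mk' E (x t₀ s) (0 : TangentSpace I (x t₀ s)) :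
        TangentBundle I M)) =ᶠ[𝓝 s₀]
        fun s ↦ (TotalSpace.mk' E (x t₀ s) (covariantDerivAlong cov (fun t' ↦ x t' s)
          (fun t' ↦ velocity I (fun t' ↦ x t' s) t') t₀) : TangentBundle I M) := by
      filter_upwards [hcol.eventually hgeo] with s hs
      rw [hs]
    rw [← covariantDerivAlong_congr_of_eventuallyEq cov hev]
    exact covariantDerivAlong_zero_field cov (x t₀) s₀
  rw [hzero, sub_zero] at hcurv
  -- replace `D_s ∂_t x` by `D_t ∂_s x` inside the outer derivative (locality)
  have hinner : covariantDerivAlong cov (fun t' ↦ x t' s₀) (fun t' ↦ covariantDerivAlong cov (x t')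
      (fun s ↦ velocity I (fun t'' ↦ x t'' s) t') s₀) t₀ =
      covariantDerivAlong cov (fun t' ↦ x t' s₀) (fun t' ↦ covariantDerivAlong cov
        (fun t'' ↦ x t'' s₀) (fun t'' ↦ velocity I (x t'') s₀) t') t₀ := by
    refine covariantDerivAlong_congr_of_eventuallyEq cov ?_
    filter_upwards [hsymm] with t ht
    rw [ht]
  rw [hinner, CovariantDerivative.curvature_antisymm] at hcurv
  rw [hcurv, neg_add_cancel]

end Jacobi

/-! ### The variation through the normal geodesics of a field along a map -/

section NormalVariation

variable [FiniteDimensional ℝ E] [CompleteSpace E] [T2Space M] [BoundarylessManifold I M]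
  {E' : Type*} [NormedAddCommGroup E'] [NormedSpace ℝ E'] {H' : Type*} [TopologicalSpace H']
  {I' : ModelWithCorners ℝ E' H'} {N : Type*} [TopologicalSpace N] [ChartedSpace H' N]
  {cov : CovariantDerivative I E (TangentSpace I : M → Type _)}
  [CovariantDerivative.ContMDiffCovariantDerivative cov 1]
  [CovariantDerivative.ContMDiffCovariantDerivative cov (⊤ : ℕ∞)]
  {ι : N → M} {ν : Π z : N, TangentSpace I (ι z)}

/-- **The variation `x(t, s) = exp_{ι(c s)}(t ν(c s))` through the normal geodesics of the field
`ν` along `ι` over a curve `c` in `N` is `C^∞` near `(t₀, s₀)`** as soon as `z ↦ (ι z, ν z) ∈ TM`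
is `C^∞`, `c` is `C^∞` near `s₀`, and `t₀ ∈ dom γ_{(ι(c s₀), ν(c s₀))}`: it is the composite of
the normal exponential map `E(z, t) = exp_{ι z}(t ν z)`, `C^∞` on its open domain
(`contMDiffAt_normalExp`, `isOpen_normalExpDomain`; Lee 2018, Prop. 5.19 and p. 133), with
`(t, s) ↦ (c s, t)`. [cite: LeeRiemannianManifolds2018, Prop. 5.19 and Thm. 5.25 (proof)] -/
theorem eventually_contMDiffAt_uncurry_normalExpVariation
    (hν : ContMDiff I' I.tangent ∞ (fun z ↦ (TotalSpace.mk' E (ι z) (ν z) : TangentBundle I M)))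
    {c : ℝ → N} {s₀ : ℝ} (hc : ∀ᶠ s in 𝓝 s₀, ContMDiffAt 𝓘(ℝ, ℝ) I' ∞ c s) {t₀ : ℝ}
    (ht₀ : t₀ ∈ maximalGeodesicDomain cov (ι (c s₀)) (ν (c s₀))) :
    ∀ᶠ q : ℝ × ℝ in 𝓝 (t₀, s₀), ContMDiffAt (𝓘(ℝ, ℝ).prod 𝓘(ℝ, ℝ)) I ∞
      (uncurry fun t s ↦ expMap cov (ι (c s)) (t • ν (c s))) q := by
  have hD : IsOpen {q : N × ℝ | q.2 ∈ maximalGeodesicDomain cov (ι q.1) (ν q.1)} :=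
    isOpen_normalExpDomain (cov := cov) (k := (⊤ : ℕ∞)) le_top hν
  have hc₀ : ContMDiffAt 𝓘(ℝ, ℝ) I' ∞ c s₀ := hc.self_of_nhds
  -- `ψ (t, s) = (c s, t)` is continuous at `(t₀, s₀)` and `C^∞` near it
  have hψc : ContinuousAt (fun q : ℝ × ℝ ↦ ((c q.2, q.1) : N × ℝ)) (t₀, s₀) :=
    (hc₀.continuousAt.comp continuousAt_snd).prodMk continuousAt_fst
  have hmem : ∀ᶠ q : ℝ × ℝ in 𝓝 (t₀, s₀),
      ((c q.2, q.1) : N × ℝ) ∈ {q : N × ℝ | q.2 ∈ maximalGeodesicDomain cov (ι q.1) (ν q.1)} :=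
    hψc.preimage_mem_nhds (hD.mem_nhds ht₀)
  have hc' : ∀ᶠ q : ℝ × ℝ in 𝓝 (t₀, s₀), ContMDiffAt 𝓘(ℝ, ℝ) I' ∞ c q.2 :=
    continuousAt_snd.eventually hc
  filter_upwards [hmem, hc'] with q hq hcq
  have hψ : ContMDiffAt (𝓘(ℝ, ℝ).prod 𝓘(ℝ, ℝ)) (I'.prod 𝓘(ℝ, ℝ)) ∞
      (fun q : ℝ × ℝ ↦ ((c q.2, q.1) : N × ℝ)) q :=
    (hcq.comp q contMDiffAt_snd).prodMk contMDiffAt_fst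
  have hΦ := contMDiffAt_normalExp (cov := cov) (k := (⊤ : ℕ∞)) le_top hν hq
  exact hΦ.comp q hψ

omit [CovariantDerivative.ContMDiffCovariantDerivative cov (⊤ : ℕ∞)] in
/-- **The `t`-curves of the variation are geodesics near `(t₀, s₀)`**: `D_t ∂_t x(t, s) = 0`
whenever `t ∈ dom γ_{(ι(c s), ν(c s))}` (`isGeodesicOn_expMap_smul`), which holds for `(t, s)`
near `(t₀, s₀)` by openness of the domain of the normal exponential map.
[cite: LeeRiemannianManifolds2018, Prop. 5.19] -/
theorem eventually_geodesic_normalExpVariation {k : ℕ∞}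
    [CovariantDerivative.ContMDiffCovariantDerivative cov k] (hk : 1 ≤ k)
    (hν : ContMDiff I' I.tangent k (fun z ↦ (TotalSpace.mk' E (ι z) (ν z) : TangentBundle I M)))
    {c : ℝ → N} {s₀ : ℝ} (hc : ContinuousAt c s₀) {t₀ : ℝ}
    (ht₀ : t₀ ∈ maximalGeodesicDomain cov (ι (c s₀)) (ν (c s₀))) :
    ∀ᶠ q : ℝ × ℝ in 𝓝 (t₀, s₀),
      q.1 ∈ maximalGeodesicDomain cov (ι (c q.2)) (ν (c q.2)) ∧
      covariantDerivAlong cov (fun t ↦ expMap cov (ι (c q.2)) (t • ν (c q.2)))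
        (fun t ↦ velocity I (fun t ↦ expMap cov (ι (c q.2)) (t • ν (c q.2))) t) q.1 = 0 := by
  have hD : IsOpen {q : N × ℝ | q.2 ∈ maximalGeodesicDomain cov (ι q.1) (ν q.1)} :=
    isOpen_normalExpDomain (cov := cov) (k := k) hk hν
  have hψc : ContinuousAt (fun q : ℝ × ℝ ↦ ((c q.2, q.1) : N × ℝ)) (t₀, s₀) :=
    (hc.comp continuousAt_snd).prodMk continuousAt_fst
  have hmem : ∀ᶠ q : ℝ × ℝ in 𝓝 (t₀, s₀),
      ((c q.2, q.1) : N × ℝ) ∈ {q : N × ℝ | q.2 ∈ maximalGeodesicDomain cov (ι q.1) (ν q.1)} :=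
    hψc.preimage_mem_nhds (hD.mem_nhds ht₀)
  filter_upwards [hmem] with q hq
  exact ⟨hq, (isGeodesicOn_expMap_smul (cov := cov) (ι (c q.2)) (ν (c q.2))).2 q.1 hq⟩

/-- **The Jacobi field of the normal exponential variation.** Let `z ↦ (ι z, ν z) ∈ TM` be `C^∞`,
`c` a curve in `N` which is `C^∞` near `s₀`, and `t₀ ∈ dom γ_{(ι(c s₀), ν(c s₀))}`; write
`x(t, s) = exp_{ι(c s)}(t ν(c s))`, `γ = x(·, s₀)`, `T = ∂_t x`, `J = ∂_s x(·, s₀)`. Then, for the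
torsion-free locally `C¹` connection `cov`: (1) `J` satisfies the Jacobi equation
`D_t D_t J + R(J, γ̇)γ̇ = 0` at `t₀`; (2) `D_t J(t₀) = D_s T(t₀, s₀)` (symmetry lemma); (3) the
lifts of `J` and of `D_t J` to `TM` are differentiable at `t₀`. (O'Neill 1983, Ch. 8, Lemma 3
and Ch. 10, Cor. 40: variations through normal geodesics give `P`-Jacobi fields; Lee 2018,
Thm. 10.1, Problem 10-14.) [cite: ONeillSemiRiemannian1983, Ch. 8, Lemma 3; Ch. 10, Cor. 40] -/
theorem normalExpVariation_jacobi (hcov₁ : cov.IsLocallyContMDiff 1) (htors : cov.torsion = 0)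
    (hν : ContMDiff I' I.tangent ∞ (fun z ↦ (TotalSpace.mk' E (ι z) (ν z) : TangentBundle I M)))
    {c : ℝ → N} {s₀ : ℝ} (hc : ∀ᶠ s in 𝓝 s₀, ContMDiffAt 𝓘(ℝ, ℝ) I' ∞ c s) {t₀ : ℝ}
    (ht₀ : t₀ ∈ maximalGeodesicDomain cov (ι (c s₀)) (ν (c s₀))) :
    (covariantDerivAlong cov (fun t ↦ expMap cov (ι (c s₀)) (t • ν (c s₀)))
        (fun t ↦ covariantDerivAlong cov (fun t ↦ expMap cov (ι (c s₀)) (t • ν (c s₀)))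
          (fun t ↦ velocity I (fun s ↦ expMap cov (ι (c s)) (t • ν (c s))) s₀) t) t₀ +
      cov.curvature (expMap cov (ι (c s₀)) (t₀ • ν (c s₀)))
        (velocity I (fun s ↦ expMap cov (ι (c s)) (t₀ • ν (c s))) s₀)
        (velocity I (fun t ↦ expMap cov (ι (c s₀)) (t • ν (c s₀))) t₀)
        (velocity I (fun t ↦ expMap cov (ι (c s₀)) (t • ν (c s₀))) t₀) = 0) ∧
    covariantDerivAlong cov (fun t ↦ expMap cov (ι (c s₀)) (t • ν (c s₀)))
        (fun t ↦ velocity I (fun s ↦ expMap cov (ι (c s)) (t • ν (c s))) s₀) t₀ =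
      covariantDerivAlong cov (fun s ↦ expMap cov (ι (c s)) (t₀ • ν (c s)))
        (fun s ↦ velocity I (fun t ↦ expMap cov (ι (c s)) (t • ν (c s))) t₀) s₀ ∧
    MDifferentiableAt 𝓘(ℝ, ℝ) I.tangent (fun t ↦ (TotalSpace.mk' E
        (expMap cov (ι (c s₀)) (t • ν (c s₀)))
        (velocity I (fun s ↦ expMap cov (ι (c s)) (t • ν (c s))) s₀) : TangentBundle I M)) t₀ ∧
    MDifferentiableAt 𝓘(ℝ, ℝ) I.tangent (fun t ↦ (TotalSpace.mk' E
        (expMap cov (ι (c s₀)) (t • ν (c s₀)))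
        (covariantDerivAlong cov (fun t ↦ expMap cov (ι (c s₀)) (t • ν (c s₀)))
          (fun t ↦ velocity I (fun s ↦ expMap cov (ι (c s)) (t • ν (c s))) s₀) t) :
        TangentBundle I M)) t₀ := by
  set x : ℝ → ℝ → M := fun t s ↦ expMap cov (ι (c s)) (t • ν (c s)) with hx_def
  have h2 : (2 : ℕ∞ω) ≤ ∞ := WithTop.coe_le_coe.2 le_top
  have hx : ∀ᶠ q : ℝ × ℝ in 𝓝 (t₀, s₀),
      ContMDiffAt (𝓘(ℝ, ℝ).prod 𝓘(ℝ, ℝ)) I ∞ (uncurry x) q :=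
    eventually_contMDiffAt_uncurry_normalExpVariation (cov := cov) hν hc ht₀
  have hgeo : ∀ᶠ q : ℝ × ℝ in 𝓝 (t₀, s₀), covariantDerivAlong cov (fun t ↦ x t q.2)
      (fun t ↦ velocity I (fun t ↦ x t q.2) t) q.1 = 0 :=
    (eventually_geodesic_normalExpVariation (cov := cov) (k := (⊤ : ℕ∞)) le_top hν
      (hc.self_of_nhds).continuousAt ht₀).mono fun q hq ↦ hq.2
  have hX2 : ∀ᶠ q in 𝓝 (t₀, s₀), ContMDiffAt (𝓘(ℝ, ℝ).prod 𝓘(ℝ, ℝ)) I 2 (uncurry x) q :=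
    hx.mono fun q hq ↦ hq.of_le h2
  have hX2₀ : ContMDiffAt (𝓘(ℝ, ℝ).prod 𝓘(ℝ, ℝ)) I 2 (uncurry x) (t₀, s₀) := hX2.self_of_nhds
  -- (1) the Jacobi equation
  have hjac := jacobi_of_variation_through_geodesics (cov := cov) hcov₁ htors hx hgeo
  -- (2) the symmetry lemma at `t₀` and near `t₀`
  have hsymm₀ := covariantDerivAlong_velocity_comm cov htors hX2₀
  have hline : Tendsto (fun t : ℝ ↦ ((t, s₀) : ℝ × ℝ)) (𝓝 t₀) (𝓝 (t₀, s₀)) :=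
    (continuous_id.prodMk continuous_const).continuousAt
  have hsymm : ∀ᶠ t in 𝓝 t₀, covariantDerivAlong cov (fun t' ↦ x t' s₀)
      (fun t' ↦ velocity I (x t') s₀) t =
      covariantDerivAlong cov (x t) (fun s ↦ velocity I (fun t' ↦ x t' s) t) s₀ := by
    filter_upwards [hline.eventually hX2] with t ht
    exact covariantDerivAlong_velocity_comm cov htors ht
  -- (3) differentiability of the lifts
  have hJ : MDifferentiableAt 𝓘(ℝ, ℝ) I.tangent
      (fun t ↦ (TotalSpace.mk' E (x t s₀) (velocity I (x t) s₀) : TangentBundle I M)) t₀ :=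
    mdifferentiableAt_lift_velocity_curry_right hX2₀
  have hT : ContMDiffAt (𝓘(ℝ, ℝ).prod 𝓘(ℝ, ℝ)) I.tangent 2
      (fun q : ℝ × ℝ ↦ (TotalSpace.mk' E (x q.1 q.2) (velocity I (fun t' ↦ x t' q.2) q.1) :
        TangentBundle I M)) (t₀, s₀) :=
    (contMDiffAt_lift_velocity_uncurry_left_of_eventually (I := I) hx).of_le h2
  have hDsT : MDifferentiableAt 𝓘(ℝ, ℝ) I.tangent (fun t' ↦ (TotalSpace.mk' E (x t' s₀)
      (covariantDerivAlong cov (x t') (fun s ↦ velocity I (fun t'' ↦ x t'' s) t') s₀) :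
        TangentBundle I M)) t₀ :=
    mdifferentiableAt_lift_covariantDerivAlong_curry_right cov hcov₁ hX2₀ hT
  have hDJ : MDifferentiableAt 𝓘(ℝ, ℝ) I.tangent (fun t' ↦ (TotalSpace.mk' E (x t' s₀)
      (covariantDerivAlong cov (fun t'' ↦ x t'' s₀) (fun t'' ↦ velocity I (x t'') s₀) t') :
        TangentBundle I M)) t₀ := by
    refine hDsT.congr_of_eventuallyEq ?_
    filter_upwards [hsymm] with t ht
    rw [ht]
  exact ⟨hjac, hsymm₀, hJ, hDJ⟩

omit [CovariantDerivative.ContMDiffCovariantDerivative cov (⊤ : ℕ∞)] [TopologicalSpace N] in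
/-- **At `t = 0` the variation is the base curve `ι ∘ c`** (`exp_y 0 = y`). [folklore] -/
theorem normalExpVariation_zero (c : ℝ → N) :
    (fun s ↦ expMap cov (ι (c s)) ((0 : ℝ) • ν (c s))) = ι ∘ c := by
  funext s
  rw [zero_smul]
  exact expMap_zero (cov := cov) (ι (c s))

omit [CovariantDerivative.ContMDiffCovariantDerivative cov (⊤ : ℕ∞)] [TopologicalSpace N] in
/-- **`J(0) = (ι ∘ c)'(s₀)`**: the initial value of the Jacobi field of the normal exponential
variation is the velocity of the base curve (for `c` through `z` with velocity `w`:
`J(0) = dι_z(w)`). O'Neill 1983, Ch. 10, Cor. 40 (`V(0)` tangent to `P`).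
[cite: ONeillSemiRiemannian1983, Ch. 10, Cor. 40] -/
theorem velocity_normalExpVariation_zero (c : ℝ → N) (s₀ : ℝ) :
    velocity I (fun s ↦ expMap cov (ι (c s)) ((0 : ℝ) • ν (c s))) s₀ = velocity I (ι ∘ c) s₀ := by
  rw [normalExpVariation_zero (cov := cov) c]

omit [CovariantDerivative.ContMDiffCovariantDerivative cov (⊤ : ℕ∞)] [TopologicalSpace N] in
/-- **`D_s T(0, s₀) = D_s (ν ∘ c)(s₀)`**: at `t = 0` the velocity field of the variation is the
field `ν ∘ c` along the base curve `ι ∘ c` (`velocity_expMap_smul_zero`), so — with the symmetry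
lemma `D_t J = D_s T` of `normalExpVariation_jacobi` — the initial derivative of the Jacobi field is
the covariant derivative of `ν` along `ι` in the direction `c'(s₀)` (for the Levi-Civita connection
and `c` the chart-straight curve: `normalDerivAlong`, i.e. `tan D_t J(0) = -S_ν(J(0))`, the
`P`-Jacobi condition of O'Neill 1983, Ch. 10, Def. 29 ff. / Cor. 40).
[cite: ONeillSemiRiemannian1983, Ch. 10, Cor. 40] -/
theorem covariantDerivAlong_normalExpVariation_zero (c : ℝ → N) (s₀ : ℝ) :
    covariantDerivAlong cov (fun s ↦ expMap cov (ι (c s)) ((0 : ℝ) • ν (c s)))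
        (fun s ↦ velocity I (fun t : ℝ ↦ expMap cov (ι (c s)) (t • ν (c s))) 0) s₀ =
      covariantDerivAlong cov (ι ∘ c) (fun s ↦ ν (c s)) s₀ := by
  have h1 : (fun s ↦ velocity I (fun t : ℝ ↦ expMap cov (ι (c s)) (t • ν (c s))) 0) =
      fun s ↦ ν (c s) :=
    funext fun s ↦ velocity_expMap_smul_zero (cov := cov) (ι (c s)) (ν (c s))
  rw [h1, normalExpVariation_zero (cov := cov) c]

/-- **The Jacobi field is the partial differential of the normal exponential map**:
`∂_s|_{s₀} exp_{ι(c s)}(t ν(c s)) = d(E(·, t))_{c s₀}(c'(s₀))` for `t ∈ dom γ_{(ι(c s₀), ν(c s₀))}`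
(chain rule, `E(z, t) = exp_{ι z}(t ν z)` being differentiable at `(c s₀, t)`). Together with
`mfderiv_normalExp_apply` this identifies the zeros of (combinations of) the Jacobi fields modulo
`γ̇` with the singular points of `E`, O'Neill 1983, Ch. 10, Prop. 30 (3).
[cite: ONeillSemiRiemannian1983, Ch. 10, Prop. 30] -/
theorem velocity_normalExpVariation_eq_mfderiv
    (hν : ContMDiff I' I.tangent ∞ (fun z ↦ (TotalSpace.mk' E (ι z) (ν z) : TangentBundle I M)))
    {c : ℝ → N} {s₀ : ℝ} (hc : MDifferentiableAt 𝓘(ℝ, ℝ) I' c s₀) {t : ℝ}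
    (ht : t ∈ maximalGeodesicDomain cov (ι (c s₀)) (ν (c s₀))) :
    velocity I (fun s ↦ expMap cov (ι (c s)) (t • ν (c s))) s₀ =
      mfderiv I' I (fun z' ↦ expMap cov (ι z') (t • ν z')) (c s₀) (velocity I' c s₀) := by
  have hΦ := contMDiffAt_normalExp (cov := cov) (k := (⊤ : ℕ∞)) le_top hν ht
  have hf : MDifferentiableAt I' I (fun z' ↦ expMap cov (ι z') (t • ν z')) (c s₀) :=
    (hΦ.comp (c s₀) (contMDiffAt_id.prodMk contMDiffAt_const)).mdifferentiableAt (by simp)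
  exact velocity_comp hf hc

/-- **The differential of the normal exponential map splits**:
`dE_{(z, t)}(w, a) = d(E(·, t))_z(w) + a γ̇(t)` for `t ∈ dom γ_{(ι z, ν z)}`, `γ = E(z, ·)` the
normal geodesic (`mfderiv_prod_eq_add_apply`; along `{z} × ℝ` the map is the geodesic). Lee 2018,
proof of Thm. 5.25; O'Neill 1983, Ch. 10, proof of Prop. 30.
[cite: LeeRiemannianManifolds2018, Thm. 5.25 (proof)] [cite: ONeillSemiRiemannian1983, Ch. 10, Prop. 30 (proof)] -/
theorem mfderiv_normalExp_apply
    (hν : ContMDiff I' I.tangent ∞ (fun z ↦ (TotalSpace.mk' E (ι z) (ν z) : TangentBundle I M)))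
    {z : N} {t : ℝ} (ht : t ∈ maximalGeodesicDomain cov (ι z) (ν z)) (w : TangentSpace I' z)
    (a : ℝ) :
    mfderiv (I'.prod 𝓘(ℝ, ℝ)) I (fun q : N × ℝ ↦ expMap cov (ι q.1) (q.2 • ν q.1)) (z, t)
        ((w, a) : TangentSpace (I'.prod 𝓘(ℝ, ℝ)) (z, t)) =
      mfderiv I' I (fun z' ↦ expMap cov (ι z') (t • ν z')) z w +
        a • velocity I (fun t' : ℝ ↦ expMap cov (ι z) (t' • ν z)) t := by
  have hΦ := contMDiffAt_normalExp (cov := cov) (k := (⊤ : ℕ∞)) le_top hν ht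
  have hd : MDifferentiableAt (I'.prod 𝓘(ℝ, ℝ)) I
      (fun q : N × ℝ ↦ expMap cov (ι q.1) (q.2 • ν q.1)) (z, t) := hΦ.mdifferentiableAt (by simp)
  rw [mfderiv_prod_eq_add_apply hd]
  show mfderiv I' I (fun z' : N ↦ expMap cov (ι z') (t • ν z')) z w +
      mfderiv 𝓘(ℝ, ℝ) I (fun t' : ℝ ↦ expMap cov (ι z) (t' • ν z)) t a = _
  congr 1
  set γ : ℝ → M := fun t' : ℝ ↦ expMap cov (ι z) (t' • ν z) with hγ
  have ha : (a : TangentSpace 𝓘(ℝ, ℝ) t) = a • ((1 : ℝ) : TangentSpace 𝓘(ℝ, ℝ) t) := by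
    change a = a * 1
    rw [mul_one]
  calc mfderiv 𝓘(ℝ, ℝ) I γ t a
      = mfderiv 𝓘(ℝ, ℝ) I γ t (a • ((1 : ℝ) : TangentSpace 𝓘(ℝ, ℝ) t)) := by rw [← ha]
    _ = a • mfderiv 𝓘(ℝ, ℝ) I γ t ((1 : ℝ) : TangentSpace 𝓘(ℝ, ℝ) t) := map_smul _ _ _
    _ = a • velocity I γ t := rfl

end NormalVariation

/-! ### The Wronskian of two Jacobi fields -/

section Wronskian

variable [FiniteDimensional ℝ E] [CompleteSpace E] {n : ℕ∞ω} [Fact (1 ≤ n)]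
  (g : PseudoRiemannianMetric I n E (TangentSpace I : M → Type _)) [g.HasLeviCivita]

/-- **The Wronskian of two Jacobi fields is constant**: along a curve `γ` and for the Levi-Civita
connection (locally `C¹`, `n ≥ 2`), if `J₁, J₂` satisfy the Jacobi equation at `t` and the lifts
of `J₁, J₂, D_t J₁, D_t J₂` are differentiable at `t`, then
`ω(t) = g(D_t J₁, J₂) - g(J₁, D_t J₂)` has `ω'(t) = 0`:
`ω' = g(D_t² J₁, J₂) - g(J₁, D_t² J₂) = -g(R(J₁, γ̇)γ̇, J₂) + g(R(J₂, γ̇)γ̇, J₁) = 0` by pair symmetry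
of the curvature (`val_curvature_dir_symm`). O'Neill 1983, Ch. 8, Lemma 7 (`⟨J₁', J₂⟩ - ⟨J₁, J₂'⟩`
is constant) and Ch. 10, proof of Lemma 33; Chavel 2006, proof of Thm. III.4.3 ("`W(𝒜, 𝒜) = 0`").
[cite: ONeillSemiRiemannian1983, Ch. 8, Lemma 7] [cite: Chavel2006, Thm. III.4.3 (proof)] -/
theorem hasDerivAt_wronskian_of_isJacobiFieldAlongOn (hreg : g.leviCivita.IsLocallyContMDiff 1)
    (hn : 2 ≤ n) {γ : ℝ → M} {J₁ J₂ : Π t : ℝ, TangentSpace I (γ t)} {s : Set ℝ} {t : ℝ}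
    (hJ₁ : IsJacobiFieldAlongOn g γ J₁ s) (hJ₂ : IsJacobiFieldAlongOn g γ J₂ s) (ht : t ∈ s)
    (hJ₁d : MDifferentiableAt 𝓘(ℝ, ℝ) I.tangent
      (fun t ↦ (TotalSpace.mk' E (γ t) (J₁ t) : TangentBundle I M)) t)
    (hJ₂d : MDifferentiableAt 𝓘(ℝ, ℝ) I.tangent
      (fun t ↦ (TotalSpace.mk' E (γ t) (J₂ t) : TangentBundle I M)) t)
    (hDJ₁d : MDifferentiableAt 𝓘(ℝ, ℝ) I.tangent
      (fun t ↦ (TotalSpace.mk' E (γ t) (covariantDerivAlong g.leviCivita γ J₁ t) :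
        TangentBundle I M)) t)
    (hDJ₂d : MDifferentiableAt 𝓘(ℝ, ℝ) I.tangent
      (fun t ↦ (TotalSpace.mk' E (γ t) (covariantDerivAlong g.leviCivita γ J₂ t) :
        TangentBundle I M)) t) :
    HasDerivAt (fun t ↦ g.val (γ t) (covariantDerivAlong g.leviCivita γ J₁ t) (J₂ t) -
        g.val (γ t) (J₁ t) (covariantDerivAlong g.leviCivita γ J₂ t)) 0 t := by
  have hLC := PseudoRiemannianMetric.isLeviCivita_leviCivita_holds (g := g)
  have h1 := g.hasDerivAt_val_apply_along hLC.2 hDJ₁d hJ₂d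
  have h2 := g.hasDerivAt_val_apply_along hLC.2 hJ₁d hDJ₂d
  have h := h1.sub h2
  refine h.congr_deriv ?_
  have e1 : covariantDerivAlong g.leviCivita γ (fun τ ↦ covariantDerivAlong g.leviCivita γ J₁ τ) t
      = -(g.leviCivita.curvature (γ t) (J₁ t) (velocity I γ t) (velocity I γ t)) :=
    eq_neg_of_add_eq_zero_left (hJ₁ t ht)
  have e2 : covariantDerivAlong g.leviCivita γ (fun τ ↦ covariantDerivAlong g.leviCivita γ J₂ τ) t
      = -(g.leviCivita.curvature (γ t) (J₂ t) (velocity I γ t) (velocity I γ t)) :=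
    eq_neg_of_add_eq_zero_left (hJ₂ t ht)
  rw [e1, e2, map_neg, neg_apply, map_neg,
    val_curvature_dir_symm g hLC.2 hreg hLC.1 hn (γ t) (J₁ t) (J₂ t) (velocity I γ t),
    g.symm (γ t) (J₁ t), g.symm (γ t) (covariantDerivAlong g.leviCivita γ J₁ t)
      (covariantDerivAlong g.leviCivita γ J₂ t)]
  ring

end Wronskian

/-! ### Null (or unit) normal data: the Jacobi fields are orthogonal to the geodesic -/

section Normality

variable [FiniteDimensional ℝ E] [CompleteSpace E] [T2Space M] [BoundarylessManifold I M]
  {E' : Type*} [NormedAddCommGroup E'] [NormedSpace ℝ E'] {H' : Type*} [TopologicalSpace H']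
  {I' : ModelWithCorners ℝ E' H'} {N : Type*} [TopologicalSpace N] [ChartedSpace H' N]
  {n : ℕ∞ω} [Fact (1 ≤ n)]
  (g : PseudoRiemannianMetric I n E (TangentSpace I : M → Type _)) [g.HasLeviCivita]
  [CovariantDerivative.ContMDiffCovariantDerivative g.leviCivita 1]
  [CovariantDerivative.ContMDiffCovariantDerivative g.leviCivita (⊤ : ℕ∞)]
  {ι : N → M} {ν : Π z : N, TangentSpace I (ι z)}

/-- **A strip around `[0, t₀] × {0}` in the domain of the variation.** If `z ↦ (ι z, ν z)` is
`C¹`... (continuity suffices), `c` is continuous at `0` and `t₀ ∈ dom γ_{(ι(c 0), ν(c 0))}`, there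
are `ε > 0` and `a < min 0 t₀`, `max 0 t₀ < b` with `t ∈ dom γ_{(ι(c s), ν(c s))}` for all
`t ∈ (a, b)`, `|s| < ε`: the domain of `γ_{(ι(c 0), ν(c 0))}` is an open interval containing `0`
and `t₀`, hence a compact interval around `[min 0 t₀, max 0 t₀]`, and the domain of the normal
exponential map is open in `N × ℝ` (`isOpen_normalExpDomain`; tube lemma).
[cite: LeeRiemannianManifolds2018, Prop. 5.19 (a)] -/
theorem exists_strip_subset_normalExpDomain {k : ℕ∞}
    {cov : CovariantDerivative I E (TangentSpace I : M → Type _)}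
    [CovariantDerivative.ContMDiffCovariantDerivative cov 1]
    [CovariantDerivative.ContMDiffCovariantDerivative cov k] (hk : 1 ≤ k)
    (hν : ContMDiff I' I.tangent k (fun z ↦ (TotalSpace.mk' E (ι z) (ν z) : TangentBundle I M)))
    {c : ℝ → N} (hc : ContinuousAt c 0) {t₀ : ℝ}
    (ht₀ : t₀ ∈ maximalGeodesicDomain cov (ι (c 0)) (ν (c 0))) :
    ∃ ε a b : ℝ, 0 < ε ∧ a < min 0 t₀ ∧ max 0 t₀ < b ∧
      ∀ t ∈ Ioo a b, ∀ s ∈ Ioo (-ε) ε, t ∈ maximalGeodesicDomain cov (ι (c s)) (ν (c s)) := by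
  obtain ⟨hmax, h0, -, -⟩ := maximalGeodesic_spec' (cov := cov) (ι (c 0)) (ν (c 0))
  set D₀ := maximalGeodesicDomain cov (ι (c 0)) (ν (c 0)) with hD₀
  have hDo : IsOpen D₀ := hmax.isOpen
  have hDc : D₀.OrdConnected := hmax.2.1
  -- a margin around `[min 0 t₀, max 0 t₀]` inside `D₀`
  have hmin : min 0 t₀ ∈ D₀ := by rcases le_total 0 t₀ with h | h <;> simp [h, h0, ht₀]
  have hmaxm : max 0 t₀ ∈ D₀ := by rcases le_total 0 t₀ with h | h <;> simp [h, h0, ht₀]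
  obtain ⟨δ₁, hδ₁, hδ₁s⟩ := Metric.isOpen_iff.1 hDo _ hmin
  obtain ⟨δ₂, hδ₂, hδ₂s⟩ := Metric.isOpen_iff.1 hDo _ hmaxm
  set a := min 0 t₀ - δ₁ / 2 with ha
  set b := max 0 t₀ + δ₂ / 2 with hb
  have haD : a ∈ D₀ := hδ₁s (by
    rw [Metric.mem_ball, Real.dist_eq, ha]
    rw [show min 0 t₀ - δ₁ / 2 - min 0 t₀ = -(δ₁ / 2) by ring, abs_neg, abs_of_pos (by linarith)]
    linarith)
  have hbD : b ∈ D₀ := hδ₂s (by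
    rw [Metric.mem_ball, Real.dist_eq, hb]
    rw [show max 0 t₀ + δ₂ / 2 - max 0 t₀ = δ₂ / 2 by ring, abs_of_pos (by linarith)]
    linarith)
  have hIcc : Icc a b ⊆ D₀ := hDc.out haD hbD
  -- tube lemma for `{c 0} × [a, b]` inside the open domain of the normal exponential map
  have hD : IsOpen {q : N × ℝ | q.2 ∈ maximalGeodesicDomain cov (ι q.1) (ν q.1)} :=
    isOpen_normalExpDomain (cov := cov) (k := k) hk hν
  have hsub : ({c 0} : Set N) ×ˢ Icc a b ⊆
      {q : N × ℝ | q.2 ∈ maximalGeodesicDomain cov (ι q.1) (ν q.1)} := by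
    rintro ⟨z, t⟩ ⟨hz, ht⟩
    rw [mem_singleton_iff] at hz
    subst hz
    exact hIcc ht
  obtain ⟨U, V, hUo, -, hzU, hIV, hUV⟩ :=
    generalized_tube_lemma isCompact_singleton isCompact_Icc hD hsub
  have hU : c ⁻¹' U ∈ 𝓝 (0 : ℝ) := hc.preimage_mem_nhds (hUo.mem_nhds (hzU rfl))
  obtain ⟨ε, hε, hεU⟩ := Metric.mem_nhds_iff.1 hU
  refine ⟨ε, a, b, hε, by rw [ha]; linarith, by rw [hb]; linarith, fun t ht s hs ↦ ?_⟩
  have hsU : c s ∈ U := hεU (by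
    rw [Metric.mem_ball, Real.dist_eq, sub_zero]
    exact abs_lt.2 ⟨hs.1, hs.2⟩)
  exact hUV (mk_mem_prod hsU (hIV (Ioo_subset_Icc_self ht)))

/-- **Normal Jacobi fields of null (or unit) normal data are orthogonal to the geodesic.** Let
`z ↦ (ι z, ν z) ∈ TM` be `C^∞` with `g(ν, ν)` constant along the curve `c` near `0` (e.g. `ν` a
null, or a unit, normal field) and `ν(c 0) ⊥ dι(c'(0))` (`ν` normal to `ι` at `c 0`), `c` being
`C^∞` near `0`. Then for every `t` in the domain of the normal geodesic `γ = γ_{(ι(c 0), ν(c 0))}`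
the Jacobi field `J(t) = ∂_s|₀ exp_{ι(c s)}(t ν(c s))` satisfies `g(J(t), γ̇(t)) = 0` — the Gauss
lemma for submanifolds in variation form
(`val_velocity_normalVariation_eq_zero_of_mem_maximalGeodesicDomain`, Lee 2018, Thm. 6.38) on a
strip furnished by `exists_strip_subset_normalExpDomain`. For null `ν` this says that the null
hypersurface generated by the normal null geodesics is indeed null (Galloway 2000, §2;
Hawking–Ellis 1973, §4.2); O'Neill 1983, Ch. 10, Lemma 8.7/p. 289 ("a `P`-Jacobi field … is
everywhere perpendicular to `σ`"). [cite: LeeRiemannianManifolds2018, Thm. 6.38] [cite: ONeillSemiRiemannian1983, Ch. 10, p. 289] -/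
theorem val_jacobi_velocity_eq_zero_of_normal
    (hν : ContMDiff I' I.tangent ∞ (fun z ↦ (TotalSpace.mk' E (ι z) (ν z) : TangentBundle I M)))
    {c : ℝ → N} (hc : ∀ᶠ s in 𝓝 0, ContMDiffAt 𝓘(ℝ, ℝ) I' ∞ c s)
    (hνν : ∀ᶠ s in 𝓝 0, g.val (ι (c s)) (ν (c s)) (ν (c s)) = g.val (ι (c 0)) (ν (c 0)) (ν (c 0)))
    (hperp : g.val (ι (c 0)) (velocity I (ι ∘ c) 0) (ν (c 0)) = 0) {t : ℝ}
    (ht : t ∈ maximalGeodesicDomain g.leviCivita (ι (c 0)) (ν (c 0))) :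
    g.val (expMap g.leviCivita (ι (c 0)) (t • ν (c 0)))
        (velocity I (fun s ↦ expMap g.leviCivita (ι (c s)) (t • ν (c s))) 0)
        (velocity I (fun t ↦ expMap g.leviCivita (ι (c 0)) (t • ν (c 0))) t) = 0 := by
  obtain ⟨ε₁, a, b, hε₁, ha, hb, hstrip⟩ := exists_strip_subset_normalExpDomain (cov := g.leviCivita)
    (k := (⊤ : ℕ∞)) le_top hν (hc.self_of_nhds).continuousAt ht
  -- shrink `ε` so that `c` is smooth and `g(ν, ν)` constant on `(-ε, ε)`
  obtain ⟨ε₂, hε₂, hε₂s⟩ := Metric.mem_nhds_iff.1 (hc.and hνν)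
  set ε := min ε₁ ε₂ with hεdef
  have hε : 0 < ε := lt_min hε₁ hε₂
  have hI : ∀ s ∈ Ioo (-ε) ε, s ∈ Ioo (-ε₁) ε₁ ∧ s ∈ Metric.ball (0 : ℝ) ε₂ := fun s hs ↦ by
    refine ⟨⟨lt_of_le_of_lt (neg_le_neg (min_le_left _ _)) hs.1,
      lt_of_lt_of_le hs.2 (min_le_left _ _)⟩, ?_⟩
    rw [Metric.mem_ball, Real.dist_eq, sub_zero]
    exact abs_lt.2 ⟨lt_of_le_of_lt (neg_le_neg (min_le_right _ _)) hs.1,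
      lt_of_lt_of_le hs.2 (min_le_right _ _)⟩
  have hcV : ∀ s ∈ Ioo (-ε) ε, ContMDiffAt 𝓘(ℝ, ℝ) I.tangent ∞
      (fun s ↦ (TotalSpace.mk' E ((ι ∘ c) s) (ν (c s)) : TangentBundle I M)) s := fun s hs ↦
    (hν (c s)).comp s (hε₂s (hI s hs).2).1
  have hstrip' : ∀ t ∈ Ioo a b, ∀ s ∈ Ioo (-ε) ε,
      t ∈ maximalGeodesicDomain g.leviCivita ((ι ∘ c) s) (ν (c s)) := fun t ht s hs ↦
    hstrip t ht s (hI s hs).1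
  have hVV : ∀ s ∈ Ioo (-ε) ε, g.val ((ι ∘ c) s) (ν (c s)) (ν (c s)) =
      g.val ((ι ∘ c) 0) (ν (c 0)) (ν (c 0)) := fun s hs ↦ (hε₂s (hI s hs).2).2
  have ha0 : a < 0 := lt_of_lt_of_le ha (min_le_left _ _)
  have hb0 : 0 < b := lt_of_le_of_lt (le_max_left _ _) hb
  have htab : t ∈ Ioo a b :=
    ⟨lt_of_lt_of_le ha (min_le_right _ _), lt_of_le_of_lt (le_max_right _ _) hb⟩
  exact val_velocity_normalVariation_eq_zero_of_mem_maximalGeodesicDomain g (k := (⊤ : ℕ∞)) rfl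
    (c := ι ∘ c) (V := fun s ↦ ν (c s)) hε ha0 hb0 hcV hstrip' hVV hperp htab

/-- **… and so are their covariant derivatives**: under the hypotheses of
`val_jacobi_velocity_eq_zero_of_normal`, `g(D_t J(t), γ̇(t)) = 0` for `t ∈ dom γ` — differentiate
`g(J, γ̇) ≡ 0` (which holds on the open domain) and use `D_t γ̇ = 0`. O'Neill 1983, Ch. 10,
Cor. 40 (proof: "`⟨V', σ'⟩ = 0`"). [cite: ONeillSemiRiemannian1983, Ch. 10, Cor. 40] -/
theorem val_covariantDerivAlong_jacobi_velocity_eq_zero_of_normal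
    (hreg : g.leviCivita.IsLocallyContMDiff 1)
    (hν : ContMDiff I' I.tangent ∞ (fun z ↦ (TotalSpace.mk' E (ι z) (ν z) : TangentBundle I M)))
    {c : ℝ → N} (hc : ∀ᶠ s in 𝓝 0, ContMDiffAt 𝓘(ℝ, ℝ) I' ∞ c s)
    (hνν : ∀ᶠ s in 𝓝 0, g.val (ι (c s)) (ν (c s)) (ν (c s)) = g.val (ι (c 0)) (ν (c 0)) (ν (c 0)))
    (hperp : g.val (ι (c 0)) (velocity I (ι ∘ c) 0) (ν (c 0)) = 0) {t : ℝ}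
    (ht : t ∈ maximalGeodesicDomain g.leviCivita (ι (c 0)) (ν (c 0))) :
    g.val (expMap g.leviCivita (ι (c 0)) (t • ν (c 0)))
        (covariantDerivAlong g.leviCivita (fun t ↦ expMap g.leviCivita (ι (c 0)) (t • ν (c 0)))
          (fun t ↦ velocity I (fun s ↦ expMap g.leviCivita (ι (c s)) (t • ν (c s))) 0) t)
        (velocity I (fun t ↦ expMap g.leviCivita (ι (c 0)) (t • ν (c 0))) t) = 0 := by
  have hLC := PseudoRiemannianMetric.isLeviCivita_leviCivita_holds (g := g)
  set γ : ℝ → M := fun t ↦ expMap g.leviCivita (ι (c 0)) (t • ν (c 0)) with hγ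
  set J : Π t : ℝ, TangentSpace I (γ t) :=
    fun t ↦ velocity I (fun s ↦ expMap g.leviCivita (ι (c s)) (t • ν (c s))) 0 with hJ
  obtain ⟨hmax, h0, -, -⟩ := maximalGeodesic_spec' (cov := g.leviCivita) (ι (c 0)) (ν (c 0))
  have hgeo : IsGeodesicOn g.leviCivita γ (maximalGeodesicDomain g.leviCivita (ι (c 0)) (ν (c 0))) :=
    isGeodesicOn_expMap_smul (cov := g.leviCivita) (ι (c 0)) (ν (c 0))
  -- `f = g(J, γ̇)` vanishes on the open domain, hence has zero derivative at `t`
  have hzero : ∀ᶠ t' in 𝓝 t, g.val (γ t') (J t') (velocity I γ t') = 0 := by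
    filter_upwards [hmax.isOpen.mem_nhds ht] with t' ht'
    exact val_jacobi_velocity_eq_zero_of_normal g hν hc hνν hperp ht'
  have hJd : MDifferentiableAt 𝓘(ℝ, ℝ) I.tangent
      (fun t ↦ (TotalSpace.mk' E (γ t) (J t) : TangentBundle I M)) t :=
    (normalExpVariation_jacobi (cov := g.leviCivita) hreg hLC.1 hν hc ht).2.2.1
  have hTd : MDifferentiableAt 𝓘(ℝ, ℝ) I.tangent
      (fun t ↦ (TotalSpace.mk' E (γ t) (velocity I γ t) : TangentBundle I M)) t := hgeo.1 t ht
  have hder := g.hasDerivAt_val_apply_along hLC.2 hJd hTd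
  have hgeq : covariantDerivAlong g.leviCivita γ (fun t ↦ velocity I γ t) t = 0 := hgeo.2 t ht
  rw [hgeq, map_zero, add_zero] at hder
  have hder0 : HasDerivAt (fun t' ↦ g.val (γ t') (J t') (velocity I γ t')) 0 t :=
    (hasDerivAt_const t (0 : ℝ)).congr_of_eventuallyEq (hzero.mono fun t' ht' ↦ ht')
  exact hder.unique hder0

/-! ### Transfer to a syntactically different presentation of the normal geodesic -/

/-- **`normalExpVariation_jacobi` along a prescribed presentation `γ` of the normal geodesic.**
If `γ = (t ↦ exp_{ι(c s₀)}(t ν(c s₀)))` as functions (e.g. `γ t = exp_{ι z}(t ν z)` for a curve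
`c` through `z = c s₀`, an equation which need not hold by `rfl`), all conclusions hold verbatim
along `γ` (by substitution). This is the form consumed when several curves `c_k` through one point
furnish Jacobi fields along one and the same geodesic. [cite: ONeillSemiRiemannian1983, Ch. 10, Cor. 40] -/
theorem normalExpVariation_jacobi_of_eq (hreg : g.leviCivita.IsLocallyContMDiff 1)
    (hν : ContMDiff I' I.tangent ∞ (fun z ↦ (TotalSpace.mk' E (ι z) (ν z) : TangentBundle I M)))
    {c : ℝ → N} {s₀ : ℝ} (hc : ∀ᶠ s in 𝓝 s₀, ContMDiffAt 𝓘(ℝ, ℝ) I' ∞ c s) {t₀ : ℝ}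
    (ht₀ : t₀ ∈ maximalGeodesicDomain g.leviCivita (ι (c s₀)) (ν (c s₀))) {γ : ℝ → M}
    (hγ : (fun t ↦ expMap g.leviCivita (ι (c s₀)) (t • ν (c s₀))) = γ) :
    (covariantDerivAlong g.leviCivita γ
        (fun t ↦ covariantDerivAlong g.leviCivita γ
          (fun t ↦ velocity I (fun s ↦ expMap g.leviCivita (ι (c s)) (t • ν (c s))) s₀) t) t₀ +
      g.leviCivita.curvature (γ t₀)
        (velocity I (fun s ↦ expMap g.leviCivita (ι (c s)) (t₀ • ν (c s))) s₀)
        (velocity I γ t₀) (velocity I γ t₀) = 0) ∧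
    covariantDerivAlong g.leviCivita γ
        (fun t ↦ velocity I (fun s ↦ expMap g.leviCivita (ι (c s)) (t • ν (c s))) s₀) t₀ =
      covariantDerivAlong g.leviCivita (fun s ↦ expMap g.leviCivita (ι (c s)) (t₀ • ν (c s)))
        (fun s ↦ velocity I (fun t ↦ expMap g.leviCivita (ι (c s)) (t • ν (c s))) t₀) s₀ ∧
    MDifferentiableAt 𝓘(ℝ, ℝ) I.tangent (fun t ↦ (TotalSpace.mk' E (γ t)
        (velocity I (fun s ↦ expMap g.leviCivita (ι (c s)) (t • ν (c s))) s₀) :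
          TangentBundle I M)) t₀ ∧
    MDifferentiableAt 𝓘(ℝ, ℝ) I.tangent (fun t ↦ (TotalSpace.mk' E (γ t)
        (covariantDerivAlong g.leviCivita γ
          (fun t ↦ velocity I (fun s ↦ expMap g.leviCivita (ι (c s)) (t • ν (c s))) s₀) t) :
        TangentBundle I M)) t₀ := by
  subst hγ
  have hLC := PseudoRiemannianMetric.isLeviCivita_leviCivita_holds (g := g)
  exact normalExpVariation_jacobi (cov := g.leviCivita) hreg hLC.1 hν hc ht₀

omit [CovariantDerivative.ContMDiffCovariantDerivative g.leviCivita (⊤ : ℕ∞)] [Fact (1 ≤ n)]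
  [TopologicalSpace N] in
/-- **Initial derivative along a prescribed presentation**: along any presentation `γ` of the
normal geodesic, given the symmetry lemma value `D_t J(0) = D_s ∂_t x(0, s₀)` (second conclusion of
`normalExpVariation_jacobi_of_eq` at `t₀ = 0`), `D_s ∂_t x(0, s₀) = D_s(ν ∘ c)(s₀)`
(`covariantDerivAlong_normalExpVariation_zero`). [cite: ONeillSemiRiemannian1983, Ch. 10, Cor. 40] -/
theorem covariantDerivAlong_normalExpVariation_zero_of_eq (c : ℝ → N) (s₀ : ℝ) {γ : ℝ → M}
    (hsymm : covariantDerivAlong g.leviCivita γ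
        (fun t ↦ velocity I (fun s ↦ expMap g.leviCivita (ι (c s)) (t • ν (c s))) s₀) 0 =
      covariantDerivAlong g.leviCivita (fun s ↦ expMap g.leviCivita (ι (c s)) ((0 : ℝ) • ν (c s)))
        (fun s ↦ velocity I (fun t ↦ expMap g.leviCivita (ι (c s)) (t • ν (c s))) 0) s₀) :
    covariantDerivAlong g.leviCivita γ
        (fun t ↦ velocity I (fun s ↦ expMap g.leviCivita (ι (c s)) (t • ν (c s))) s₀) 0 =
      covariantDerivAlong g.leviCivita (ι ∘ c) (fun s ↦ ν (c s)) s₀ := by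
  rw [hsymm]
  exact covariantDerivAlong_normalExpVariation_zero (cov := g.leviCivita) c s₀

/-- **Normality along a prescribed presentation**: with `γ = (t ↦ exp_{ι(c 0)}(t ν(c 0)))`,
`g(J(t), γ̇(t)) = 0` and `g(D_t J(t), γ̇(t)) = 0` for `t ∈ dom γ` under the hypotheses of
`val_jacobi_velocity_eq_zero_of_normal` (null or unit normal data).
[cite: ONeillSemiRiemannian1983, Ch. 10, Cor. 40] -/
theorem val_jacobi_velocity_eq_zero_of_normal_of_eq (hreg : g.leviCivita.IsLocallyContMDiff 1)
    (hν : ContMDiff I' I.tangent ∞ (fun z ↦ (TotalSpace.mk' E (ι z) (ν z) : TangentBundle I M)))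
    {c : ℝ → N} (hc : ∀ᶠ s in 𝓝 0, ContMDiffAt 𝓘(ℝ, ℝ) I' ∞ c s)
    (hνν : ∀ᶠ s in 𝓝 0, g.val (ι (c s)) (ν (c s)) (ν (c s)) = g.val (ι (c 0)) (ν (c 0)) (ν (c 0)))
    (hperp : g.val (ι (c 0)) (velocity I (ι ∘ c) 0) (ν (c 0)) = 0) {t : ℝ}
    (ht : t ∈ maximalGeodesicDomain g.leviCivita (ι (c 0)) (ν (c 0))) {γ : ℝ → M}
    (hγ : (fun t ↦ expMap g.leviCivita (ι (c 0)) (t • ν (c 0))) = γ) :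
    g.val (γ t) (velocity I (fun s ↦ expMap g.leviCivita (ι (c s)) (t • ν (c s))) 0)
        (velocity I γ t) = 0 ∧
      g.val (γ t) (covariantDerivAlong g.leviCivita γ
          (fun t ↦ velocity I (fun s ↦ expMap g.leviCivita (ι (c s)) (t • ν (c s))) 0) t)
        (velocity I γ t) = 0 := by
  subst hγ
  exact ⟨val_jacobi_velocity_eq_zero_of_normal g hν hc hνν hperp ht,
    val_covariantDerivAlong_jacobi_velocity_eq_zero_of_normal g hreg hν hc hνν hperp ht⟩

end Normality



end Literature.Geometry.Lorentzian

end
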